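import Literature.Topology.FourManifolds.CorkDecomposition
import Literature.Topology.FourManifolds.CorkDecompositionSplitting
import HarnessLib

/-!
# Transport of boundary data and of gluings along the boundary across universes

Topic `Literature/Topology/FourManifolds` (fact seat
`provefact-Literature.Topology.FourManifolds.Matvey-69322e0896`, rung (H4)
`Literature.Topology.FourManifolds.Matveyev1996_partOne_and_fact_of_dualSpheres` of
`CorkDecompositionMiddleLevel.lean`, which quantifies over manifolds `X₁ X₂ N : Type u` and
concludes with pieces `W₁ W₂ M : Type u`, whereas the surgical engines of the tree live in `Type`;
infrastructure for the universe lift `…_of_univ_zero`).  The tree transports a gluing along the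
boundary `P = C₂ ∪_φ W` along a diffeomorphism of a piece (`IsBoundaryGluing.transfer`,
`IsBoundaryGluing.of_diffeomorph_right`) and restricts diffeomorphisms to boundary data
(`BoundaryData.restrictDiffeomorph`) **within one universe** (and `IsBoundaryGluing` itself asks
for its two pieces in one universe); lifting a decomposition from `Type`
to `Type u` (pieces `ULift W`) needs the same statements for a diffeomorphism
`g : C₁ ≃ₘ C₂` between manifolds of *different* universes.  This file provides them, with the
restricted diffeomorphism `∂g` packaged existentially by its defining equation
`b₂.incl ∘ ∂g = g ∘ b₁.incl` (Lee 2013, Thm. 5.11, Cor. 5.30; Hirsch 1976, §8.2: the glued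
manifold only depends on the pieces up to diffeomorphism compatible with the gluing map).
Everything here is proved; no definitions, no named facts:

* `Literature.Topology.FourManifolds.BoundaryData.exists_restrict_univ` — `∂g : ∂C₁ ≅ ∂C₂`;
* `Literature.Topology.FourManifolds.IsBoundaryGluing.transfer_univ` — `P = C₂ ∪_φ W₂` and
  `g : C₁ ≅ C₂`, `gW : W₁ ≅ W₂` (both pieces change universe at once, as `IsBoundaryGluing`
  wants its two pieces in one universe) give `P = C₁ ∪_{∂gW⁻¹ ∘ φ ∘ ∂g} W₁`;
* `Literature.Topology.FourManifolds.IsBoundaryGluing.diffeomorph_comp_target` — `P = M ∪_φ N`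
  and `e : P ≅ P'` give `P' = M ∪_φ N`. DEPRECATED (2026-08-16): this is, binder for binder
  (`P P' : Type*` already there), the tree's `IsBoundaryGluing.diffeomorph_comp` of
  `CorkDecompositionSplitting.lean`, which this file imports; use that name.

## References

* J. M. Lee, *Introduction to Smooth Manifolds*, 2nd ed. (2013), Thm. 5.11, Cor. 5.30.
  [LeeSmoothManifolds2013]
* M. W. Hirsch, *Differential Topology*, GTM 33 (1976), Ch. 8 §2. [HirschDT1976]
-/

noncomputable section

open scoped Manifold ContDiff Topology
open Set Function

namespace Literature.Topology.FourManifolds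

universe u v w

section Restrict

variable {E H E₀ H₀ E₀' H₀' : Type*} [NormedAddCommGroup E] [NormedSpace ℝ E] [TopologicalSpace H]
  [NormedAddCommGroup E₀] [NormedSpace ℝ E₀] [TopologicalSpace H₀]
  [NormedAddCommGroup E₀'] [NormedSpace ℝ E₀'] [TopologicalSpace H₀']
  {I : ModelWithCorners ℝ E H} {I₀ : ModelWithCorners ℝ E₀ H₀} {I₀' : ModelWithCorners ℝ E₀' H₀'}
  {C₁ : Type u} {C₂ : Type v} [TopologicalSpace C₁] [ChartedSpace H C₁] [TopologicalSpace C₂]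
  [ChartedSpace H C₂]

namespace BoundaryData

/-- A diffeomorphism `g : C₁ ≅ C₂` (any universes) maps the image of any boundary datum of `C₁`
into the image of any boundary datum of `C₂` (invariance of the boundary,
`Diffeomorph.image_boundary`). [folklore] -/
theorem apply_incl_mem_range_incl_univ (g : C₁ ≃ₘ⟮I, I⟯ C₂) (b₁ : BoundaryData I C₁ I₀)
    (b₂ : BoundaryData I C₂ I₀') (z : b₁.carrier) : g (b₁.incl z) ∈ range b₂.incl := by
  rw [b₂.range_incl, ← Diffeomorph.image_boundary (by simp) g]
  exact mem_image_of_mem g (b₁.incl_mem_boundary z)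

/-- **Restriction of a diffeomorphism to the boundary, across universes** (Lee 2013, Thm. 5.11
and Cor. 5.30): a diffeomorphism `g : C₁ ≅ C₂` of manifolds with boundary restricts to a
diffeomorphism `∂g : ∂C₁ ≅ ∂C₂` of any boundary data, characterised by
`b₂.incl (∂g z) = g (b₁.incl z)` (the tree's `BoundaryData.restrictDiffeomorph` for `C₁`, `C₂`
in one universe). [cite: LeeSmoothManifolds2013, Thm. 5.11 and Cor. 5.30] -/
theorem exists_restrict_univ (b₁ : BoundaryData I C₁ I₀) (b₂ : BoundaryData I C₂ I₀')
    (g : C₁ ≃ₘ⟮I, I⟯ C₂) :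
    ∃ r : b₁.carrier ≃ₘ⟮I₀, I₀'⟯ b₂.carrier, ∀ z, b₂.incl (r z) = g (b₁.incl z) := by
  -- the bijection
  let toF : b₁.carrier → b₂.carrier := fun z =>
    (Equiv.ofInjective b₂.incl b₂.injective_incl).symm
      ⟨g (b₁.incl z), apply_incl_mem_range_incl_univ g b₁ b₂ z⟩
  let invF : b₂.carrier → b₁.carrier := fun w =>
    (Equiv.ofInjective b₁.incl b₁.injective_incl).symm
      ⟨g.symm (b₂.incl w), apply_incl_mem_range_incl_univ g.symm b₂ b₁ w⟩
  have htoF : ∀ z, b₂.incl (toF z) = g (b₁.incl z) := fun z =>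
    Equiv.apply_ofInjective_symm b₂.injective_incl _
  have hinvF : ∀ w, b₁.incl (invF w) = g.symm (b₂.incl w) := fun w =>
    Equiv.apply_ofInjective_symm b₁.injective_incl _
  let r : b₁.carrier ≃ b₂.carrier :=
    { toFun := toF
      invFun := invF
      left_inv := fun z => b₁.injective_incl (by rw [hinvF, htoF, Diffeomorph.symm_apply_apply])
      right_inv := fun w => b₂.injective_incl (by rw [htoF, hinvF, Diffeomorph.apply_symm_apply]) }
  have hr : b₂.incl ∘ r = g ∘ b₁.incl := funext htoF
  have hr' : b₁.incl ∘ r.symm = g.symm ∘ b₂.incl := funext hinvF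
  have hc : Continuous r := by
    rw [b₂.isSmoothEmbedding.isEmbedding.continuous_iff, hr]
    exact g.continuous.comp b₁.continuous_incl
  have hc' : Continuous r.symm := by
    rw [b₁.isSmoothEmbedding.isEmbedding.continuous_iff, hr']
    exact g.symm.continuous.comp b₂.continuous_incl
  have hs : ContMDiff I₀ I₀' ∞ r := by
    rw [ContMDiff.iff_comp_isImmersion b₂.isSmoothEmbedding.isImmersion, hr]
    exact ⟨hc, g.contMDiff.comp b₁.isSmoothEmbedding.contMDiff⟩
  have hs' : ContMDiff I₀' I₀ ∞ r.symm := by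
    rw [ContMDiff.iff_comp_isImmersion b₁.isSmoothEmbedding.isImmersion, hr']
    exact ⟨hc', g.symm.contMDiff.comp b₂.isSmoothEmbedding.contMDiff⟩
  exact ⟨{ toEquiv := r, contMDiff_toFun := hs, contMDiff_invFun := hs' }, htoF⟩

end BoundaryData

end Restrict

section Transfer

variable {E H E₀ H₀ : Type*} [NormedAddCommGroup E] [NormedSpace ℝ E] [TopologicalSpace H]
  [NormedAddCommGroup E₀] [NormedSpace ℝ E₀] [TopologicalSpace H₀]
  {I : ModelWithCorners ℝ E H} {I₀ : ModelWithCorners ℝ E₀ H₀}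
  {EW HW EP HP E₁ H₁ : Type*} [NormedAddCommGroup EW] [NormedSpace ℝ EW]
  [TopologicalSpace HW] {IW : ModelWithCorners ℝ EW HW}
  [NormedAddCommGroup E₁] [NormedSpace ℝ E₁] [TopologicalSpace H₁] {I₁ : ModelWithCorners ℝ E₁ H₁}
  [NormedAddCommGroup EP] [NormedSpace ℝ EP] [TopologicalSpace HP] {IP : ModelWithCorners ℝ EP HP}
  {C₁ : Type u} {W₁ : Type u} [TopologicalSpace C₁] [ChartedSpace H C₁] [TopologicalSpace W₁]
  [ChartedSpace HW W₁]
  {C₂ : Type v} {W₂ : Type v} [TopologicalSpace C₂] [ChartedSpace H C₂] [TopologicalSpace W₂]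
  [ChartedSpace HW W₂]
  {P : Type*} [TopologicalSpace P] [ChartedSpace HP P]
  {b₁ : BoundaryData I C₁ I₀} {b₂ : BoundaryData I C₂ I₀} {bW₁ : BoundaryData IW W₁ I₁}
  {bW₂ : BoundaryData IW W₂ I₁}

/-- **Transport of a gluing along diffeomorphisms of both pieces, across universes**
(Hirsch 1976, §8.2): if `P = C₂ ∪_φ W₂` (pieces in one universe) and `g : C₁ ≅ C₂`,
`gW : W₁ ≅ W₂` are diffeomorphisms from pieces of another universe restricting on the boundary
data to bijections `r`, `rW` (`b₂.incl (r z) = g (b₁.incl z)`, `bW₂.incl (rW z) = gW (bW₁.incl z)`),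
then `P = C₁ ∪_{rW⁻¹ ∘ φ ∘ r} W₁` (the tree's `IsBoundaryGluing.transfer` and
`IsBoundaryGluing.of_diffeomorph_right`, one piece at a time within one universe).
[cite: HirschDT1976, Ch. 8 §2] -/
theorem IsBoundaryGluing.transfer_univ [IsManifold I ∞ C₁] [IsManifold I ∞ C₂]
    [IsManifold IW ∞ W₁] [IsManifold IW ∞ W₂]
    {φ : b₂.carrier → bW₂.carrier} (g : C₁ ≃ₘ⟮I, I⟯ C₂) (r : b₁.carrier ≃ b₂.carrier)
    (hr : ∀ z, b₂.incl (r z) = g (b₁.incl z))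
    (gW : W₁ ≃ₘ⟮IW, IW⟯ W₂) (rW : bW₁.carrier ≃ bW₂.carrier)
    (hrW : ∀ z, bW₂.incl (rW z) = gW (bW₁.incl z))
    (h : IsBoundaryGluing b₂ bW₂ φ IP P) :
    IsBoundaryGluing b₁ bW₁ (rW.symm ∘ φ ∘ r) IP P := by
  obtain ⟨jA, jB, hA, hB, hU, hR⟩ := h
  have hs : Surjective (⇑g) := g.surjective
  have hsW : Surjective (⇑gW) := gW.surjective
  have hr' : ∀ z, b₁.incl (r.symm z) = g.symm (b₂.incl z) := fun z => by
    rw [← Diffeomorph.symm_apply_apply g (b₁.incl (r.symm z)), ← hr, Equiv.apply_symm_apply]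
  have hrW' : ∀ z, bW₁.incl (rW.symm z) = gW.symm (bW₂.incl z) := fun z => by
    rw [← Diffeomorph.symm_apply_apply gW (bW₁.incl (rW.symm z)), ← hrW, Equiv.apply_symm_apply]
  refine ⟨jA ∘ g, jB ∘ gW, hA.comp_diffeomorph g, hB.comp_diffeomorph gW, ?_, fun a b => ?_⟩
  · rwa [hs.range_comp, hsW.range_comp]
  · rw [comp_apply, comp_apply, hR (g a) (gW b)]
    constructor
    · rintro ⟨z, ha, hb⟩
      refine ⟨r.symm z, ?_, ?_⟩
      · rw [hr', ← ha, Diffeomorph.symm_apply_apply]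
      · rw [comp_apply, comp_apply, Equiv.apply_symm_apply, hrW', ← hb,
          Diffeomorph.symm_apply_apply]
    · rintro ⟨z, rfl, hb⟩
      refine ⟨r z, (hr z).symm, ?_⟩
      rw [hb, comp_apply, comp_apply, ← Diffeomorph.apply_symm_apply gW (bW₂.incl (φ (r z))),
        ← hrW']

end Transfer

section Target

variable {EM HM EN HN E₀ H₀ E₀' H₀' EP HP : Type*}
  [NormedAddCommGroup EM] [NormedSpace ℝ EM] [TopologicalSpace HM] {IM : ModelWithCorners ℝ EM HM}
  [NormedAddCommGroup EN] [NormedSpace ℝ EN] [TopologicalSpace HN] {IN : ModelWithCorners ℝ EN HN}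
  [NormedAddCommGroup E₀] [NormedSpace ℝ E₀] [TopologicalSpace H₀] {I₀ : ModelWithCorners ℝ E₀ H₀}
  [NormedAddCommGroup E₀'] [NormedSpace ℝ E₀'] [TopologicalSpace H₀']
  {I₀' : ModelWithCorners ℝ E₀' H₀'}
  [NormedAddCommGroup EP] [NormedSpace ℝ EP] [TopologicalSpace HP] {IP : ModelWithCorners ℝ EP HP}
  {M : Type u} [TopologicalSpace M] [ChartedSpace HM M]
  {N : Type u} [TopologicalSpace N] [ChartedSpace HN N]
  {P : Type*} [TopologicalSpace P] [ChartedSpace HP P]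
  {P' : Type*} [TopologicalSpace P'] [ChartedSpace HP P']

/-- **Transport of a gluing along a diffeomorphism of the glued manifold** (any universes;
Hirsch 1976, §8.2): if `P = M ∪_φ N` and `e : P ≅ P'` (same model), then `P' = M ∪_φ N`.
Duplicate of `IsBoundaryGluing.diffeomorph_comp` (`CorkDecompositionSplitting.lean`, same
binders `P P' : Type*`); kept only as a deprecated alias. [cite: HirschDT1976, Ch. 8 §2] -/
@[deprecated IsBoundaryGluing.diffeomorph_comp (since := "2026-08-16")]
theorem IsBoundaryGluing.diffeomorph_comp_target [IsManifold IP ∞ P] [IsManifold IP ∞ P']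
    {bM : BoundaryData IM M I₀} {bN : BoundaryData IN N I₀'} {φ : bM.carrier → bN.carrier}
    (h : IsBoundaryGluing bM bN φ IP P) (e : P ≃ₘ⟮IP, IP⟯ P') : IsBoundaryGluing bM bN φ IP P' :=
  IsBoundaryGluing.diffeomorph_comp h e

end Target

end Literature.Topology.FourManifolds

end
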